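import Literature.NumberTheory.Sieve.FriedlanderIwaniecPrimesLemma51
import HarnessLib

/-!
# Friedlander–Iwaniec, *The polynomial `X² + Y⁴` captures its primes*, §6 (6.3)–(6.7): `𝒞(z₁, z₂)` as a congruence sum

Family `parity`, statement parity.S17. Source: J. Friedlander, H. Iwaniec, Ann. of Math. (2) 148
(1998), 945–1040 [FriedlanderIwaniecAnnals1998], §6: "The variable of summation `w` in (5.27) which
runs over Gaussian integers can be parameterized by two squares of rational integers; (6.3)
`Re w̄ z₁ = c₁²`, `Re w̄ z₂ = c₂²` say, with `c₁, c₂ ∈ ℤ`. Indeed these values determine `w` by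
`iΔw = c₁² z₂ - c₂² z₁`. As `w` ranges freely over `ℤ[i]` the above equation is equivalent to the
congruence (6.4) `c₁² z₂ ≡ c₂² z₁ (mod |Δ|)` … Applying the above transformations we write (5.27)
as (6.7) `𝒞(z₁, z₂) = Σ_{c₁² z₂ ≡ c₂² z₁ (mod |Δ|)} f((c₁² z₂ - c₂² z₁)/Δ)`."

This file PROVES (6.7) in finite form (`sum_zeta_zeta_eq_sum_congr`): for `z₁, z₂ ∈ ℤ²` with
`Δ = det2 z₁ z₂ ≠ 0` and `f` supported in a box,
`Σ_w f(w) 𝔷(Re w̄ z₁) 𝔷(Re w̄ z₂) = Σ_{(c₁, c₂)} [Δ ∣ c₁² s₂ - c₂² s₁, Δ ∣ c₂² r₁ - c₁² r₂] f(w(c₁, c₂))`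
with `w(c₁, c₂) = ((c₁² s₂ - c₂² s₁)/Δ, (c₂² r₁ - c₁² r₂)/Δ)` (`wOf`; in complex notation
`iΔ w = c₁² z₂ - c₂² z₁`), by Cramer's rule (`cramer_fst`, `cramer_snd` of `…Lemma51`).

## References

* J. Friedlander, H. Iwaniec, Ann. of Math. (2) 148 (1998), 945–1040, §6 (6.3)–(6.7).
  [FriedlanderIwaniecAnnals1998]
-/

open Finset

namespace Literature.NumberTheory.Sieve.FriedlanderIwaniecPrimes

/-- The `w` determined by `(c₁, c₂)` through (6.3): `iΔ w = c₁² z₂ - c₂² z₁`, i.e.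
`w = ((c₁² s₂ - c₂² s₁)/Δ, (c₂² r₁ - c₁² r₂)/Δ)`. [cite: FriedlanderIwaniecAnnals1998, (6.3)] -/
def wOf (z₁ z₂ c : ℤ × ℤ) : ℤ × ℤ :=
  ((c.1 ^ 2 * z₂.2 - c.2 ^ 2 * z₁.2) / det2 z₁ z₂, (c.2 ^ 2 * z₁.1 - c.1 ^ 2 * z₂.1) / det2 z₁ z₂)

/-- The congruence (6.4) `c₁² z₂ ≡ c₂² z₁ (mod |Δ|)` as the two rational divisibilities.
[cite: FriedlanderIwaniecAnnals1998, (6.4)-(6.5)] -/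
def CongrPair (z₁ z₂ c : ℤ × ℤ) : Prop :=
  det2 z₁ z₂ ∣ c.1 ^ 2 * z₂.2 - c.2 ^ 2 * z₁.2 ∧ det2 z₁ z₂ ∣ c.2 ^ 2 * z₁.1 - c.1 ^ 2 * z₂.1

/-- `CongrPair` is decidable. [folklore] -/
instance (z₁ z₂ c : ℤ × ℤ) : Decidable (CongrPair z₁ z₂ c) := inferInstanceAs (Decidable (_ ∧ _))

/-- If the congruence holds then `w(c₁, c₂)` solves (6.3). [cite: FriedlanderIwaniecAnnals1998, (6.3)-(6.4)] -/
theorem reConj_wOf {z₁ z₂ c : ℤ × ℤ} (hΔ : det2 z₁ z₂ ≠ 0) (h : CongrPair z₁ z₂ c) :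
    reConj (wOf z₁ z₂ c) z₁ = c.1 ^ 2 ∧ reConj (wOf z₁ z₂ c) z₂ = c.2 ^ 2 := by
  obtain ⟨⟨a, ha⟩, ⟨b, hb⟩⟩ := h
  have h1 : (c.1 ^ 2 * z₂.2 - c.2 ^ 2 * z₁.2) / det2 z₁ z₂ = a := by
    rw [ha, Int.mul_ediv_cancel_left _ hΔ]
  have h2 : (c.2 ^ 2 * z₁.1 - c.1 ^ 2 * z₂.1) / det2 z₁ z₂ = b := by
    rw [hb, Int.mul_ediv_cancel_left _ hΔ]
  unfold wOf reConj
  simp only [h1, h2]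
  unfold det2 at ha hb hΔ
  constructor
  · have e : (a * z₁.1 + b * z₁.2) * (z₁.1 * z₂.2 - z₂.1 * z₁.2) =
        c.1 ^ 2 * (z₁.1 * z₂.2 - z₂.1 * z₁.2) := by linear_combination -z₁.1 * ha - z₁.2 * hb
    exact mul_right_cancel₀ hΔ e
  · have e : (a * z₂.1 + b * z₂.2) * (z₁.1 * z₂.2 - z₂.1 * z₁.2) =
        c.2 ^ 2 * (z₁.1 * z₂.2 - z₂.1 * z₁.2) := by linear_combination -z₂.1 * ha - z₂.2 * hb
    exact mul_right_cancel₀ hΔ e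

/-- Conversely a solution `w` of (6.3) satisfies the congruence and equals `w(c₁, c₂)` (Cramer).
[cite: FriedlanderIwaniecAnnals1998, (6.3)-(6.4)] -/
theorem eq_wOf_of_reConj {z₁ z₂ w : ℤ × ℤ} {c₁ c₂ : ℤ} (hΔ : det2 z₁ z₂ ≠ 0)
    (h1 : reConj w z₁ = c₁ ^ 2) (h2 : reConj w z₂ = c₂ ^ 2) :
    CongrPair z₁ z₂ (c₁, c₂) ∧ w = wOf z₁ z₂ (c₁, c₂) := by
  have e1 := cramer_fst h1 h2
  have e2 := cramer_snd h1 h2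
  refine ⟨⟨⟨w.1, by rw [← e1, mul_comm]⟩, ⟨w.2, by rw [← e2, mul_comm]⟩⟩, ?_⟩
  unfold wOf
  ext
  · simp only; rw [← e1, Int.mul_ediv_cancel _ hΔ]
  · simp only; rw [← e2, Int.mul_ediv_cancel _ hΔ]

/-- **(6.7), finite form**: for `Δ(z₁, z₂) ≠ 0` and `f` supported in the box `[-R, R]²`, with `C`
so large that `|Re w̄ z_i| < C²` on the box,
`Σ_{w} f(w) 𝔷(Re w̄ z₁) 𝔷(Re w̄ z₂) = Σ_{(c₁,c₂) ∈ [-C, C]², (6.4)} f(w(c₁, c₂))`.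
[cite: FriedlanderIwaniecAnnals1998, (6.3)-(6.7)] -/
theorem sum_zeta_zeta_eq_sum_congr (z₁ z₂ : ℤ × ℤ) (hΔ : det2 z₁ z₂ ≠ 0) (f : ℤ × ℤ → ℝ) (R C : ℕ)
    (hsupp : ∀ w, f w ≠ 0 → w ∈ intBox R)
    (hC : ∀ w ∈ intBox R, (reConj w z₁).natAbs < C ^ 2 ∧ (reConj w z₂).natAbs < C ^ 2) :
    ∑ w ∈ intBox R, f w * ((fiZeta (reConj w z₁) * fiZeta (reConj w z₂) : ℕ) : ℝ) =
      ∑ c ∈ intBox C, if CongrPair z₁ z₂ c then f (wOf z₁ z₂ c) else 0 := by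
  -- Step 1: 𝔷 𝔷 as a count over the c-box
  have hstep1 : ∀ w ∈ intBox R, ((fiZeta (reConj w z₁) * fiZeta (reConj w z₂) : ℕ) : ℝ) =
      ∑ c ∈ intBox C, if reConj w z₁ = c.1 ^ 2 ∧ reConj w z₂ = c.2 ^ 2 then (1 : ℝ) else 0 := by
    intro w hw
    obtain ⟨hb1, hb2⟩ := hC w hw
    rw [fiZeta_eq_card hb1, fiZeta_eq_card hb2, ← card_product, ← filter_product]
    rw [sum_boole]
    unfold intBox
    congr 2
    ext c
    simp only [mem_filter, mem_product]
    constructor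
    · rintro ⟨⟨h1, h3⟩, h2, h4⟩; exact ⟨⟨h1, h3⟩, h2.symm, h4.symm⟩
    · rintro ⟨⟨h1, h3⟩, h2, h4⟩; exact ⟨⟨h1, h3⟩, h2.symm, h4.symm⟩
  rw [sum_congr rfl fun w hw => by rw [hstep1 w hw]]
  simp_rw [mul_sum, mul_ite, mul_one, mul_zero]
  rw [sum_comm]
  refine sum_congr rfl fun c _ => ?_
  -- Step 2: for fixed c, at most one w, namely wOf c
  by_cases hcp : CongrPair z₁ z₂ c
  · rw [if_pos hcp]
    obtain ⟨e1, e2⟩ := reConj_wOf hΔ hcp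
    by_cases hmem : wOf z₁ z₂ c ∈ intBox R
    · rw [← sum_filter, show (intBox R).filter (fun w => reConj w z₁ = c.1 ^ 2 ∧ reConj w z₂ = c.2 ^ 2) =
          {wOf z₁ z₂ c} from ?_, sum_singleton]
      ext w
      simp only [mem_filter, mem_singleton]
      constructor
      · rintro ⟨-, h1, h2⟩; exact (eq_wOf_of_reConj hΔ h1 h2).2
      · rintro rfl; exact ⟨hmem, e1, e2⟩
    · have hf0 : f (wOf z₁ z₂ c) = 0 := by
        by_contra hne; exact hmem (hsupp _ hne)
      rw [hf0]
      refine sum_eq_zero fun w hw => ?_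
      split_ifs with hh
      · obtain rfl := (eq_wOf_of_reConj hΔ hh.1 hh.2).2
        exact hf0
      · rfl
  · rw [if_neg hcp]
    refine sum_eq_zero fun w _ => ?_
    split_ifs with hh
    · exact absurd (eq_wOf_of_reConj hΔ hh.1 hh.2).1 hcp
    · rfl

end Literature.NumberTheory.Sieve.FriedlanderIwaniecPrimes
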